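import Mathlib
import Summits.Ventures.PercRepro.TriangleCapBandLocusLevel

/-!
# PercRepro — THE SMALL ROWS: THE BAND `t` OF THE ROW `a` IS TRUNCATED WHEN `a ≤ t` (p3, gen 51; part 236)

In the missing graph `H` of an `a`-bipartite graph the off-edges at a left vertex `w` each meet the `ℓ = a − 1`
other left vertices exactly once; two off-edges at the same left vertex intersect.  With `c_x` the number of
off-edges at the left vertex `x` (`Σ_x c_x = t`) the intersecting ordered pairs are at least
`Σ_x c_x (c_x − 1)`, and the tangent-line bound `2 q c ≤ c (c − 1) + q (q + 1)` (every integer `c`, `q`; equality at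
`c ∈ {q, q + 1}`) gives `Σ_x c_x (c_x − 1) ≥ 2 q t − ℓ q (q + 1)` for every `q`.  Hence, at a band-`t` value
`2 t (r − t − 1) + 2 j` of the row `a` (`2 j = 2 (t − attach) + (t (t − 1) − offAdjPairs)`):

  **`2 j + 2 q t ≤ 2 t + t (t − 1) + (a − 1) q (q + 1)`**   for every `q`   (`row_band_bound`),

sharp at `q = ⌊t / (a − 1)⌋`: the band `t` of the row `a` stops at `j = t + C(t, 2) − (a − 1) C(q, 2) − ρ q`
(`t = q (a − 1) + ρ`).  The triangle-free form (`band_bound_of_left_ends`): a vertex `w` whose off-edges each meet a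
set `L` of `ℓ` vertices exactly once.  On the cell (`cherry_row_band_bound`, `a + t < r` so that the star centre is a
left vertex), the `K₄⁻`-free graphs at a band-`t` value obey the bound.  Axioms: standard.
-/

namespace PercRepro

namespace TriangleCap

namespace C047

open Finset

variable {V : Type*} [Fintype V] [DecidableEq V]

/-- **THE TANGENT-LINE BOUND:** `2 q c ≤ c (c − 1) + q (q + 1)` for all naturals (equality iff `c ∈ {q, q + 1}`). -/
theorem two_mul_le_mul_pred_add (c q : ℕ) : 2 * q * c ≤ c * (c - 1) + q * (q + 1) := by
  rcases Nat.eq_zero_or_pos c with rfl | hc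
  · simp
  · obtain ⟨c', rfl⟩ : ∃ c', c = c' + 1 := ⟨c - 1, by omega⟩
    rw [Nat.add_sub_cancel]
    rcases Nat.lt_or_ge c' q with h | h
    · obtain ⟨d, rfl⟩ : ∃ d, q = c' + 1 + d := ⟨q - c' - 1, by omega⟩
      nlinarith
    · obtain ⟨d, rfl⟩ : ∃ d, c' = q + d := ⟨c' - q, by omega⟩
      nlinarith

/-- The off-degrees over a set `L` met exactly once by every off-edge sum to the number of off-edges. -/
theorem sum_offDeg_eq_card_of_once (H : SimpleGraph V) [DecidableRel H.Adj] (w : V) (L : Finset V)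
    (hL : ∀ e ∈ offEdges H w, (L.filter (fun x => x ∈ e)).card = 1) :
    ∑ x ∈ L, offDeg H w x = (offEdges H w).card := by
  unfold offDeg
  simp_rw [card_filter]
  rw [sum_comm]
  rw [card_eq_sum_ones]
  apply sum_congr rfl
  intro e he
  have := hL e he
  rw [card_filter] at this
  exact this

/-- The intersecting ordered pairs dominate the pairs sharing a vertex of `L` (`w ∉ L`). -/
theorem sum_offDeg_mul_pred_le (H : SimpleGraph V) [DecidableRel H.Adj] (w : V) (L : Finset V) (hw : w ∉ L) :
    ∑ x ∈ L, offDeg H w x * (offDeg H w x - 1) ≤ offAdjPairs H w := by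
  rw [← sum_erase_offDeg_mul_pred]
  apply sum_le_sum_of_subset_of_nonneg
  · intro x hx
    exact mem_erase.mpr ⟨fun h => hw (h ▸ hx), mem_univ x⟩
  · intros
    exact Nat.zero_le _

/-- **THE BAND BOUND FROM THE LEFT ENDS** (triangle-free form): at a vertex `w` with `t` off-edges, each meeting
a set `L` of `ℓ` vertices (`w ∉ L`) exactly once, at the band value `2 t (s − t − 1) + 2 j`:
`2 j + 2 q t ≤ 2 t + t (t − 1) + ℓ q (q + 1)` for every `q`. -/
theorem band_bound_of_left_ends (H : SimpleGraph V) [DecidableRel H.Adj] (s t j : ℕ) (hm : H.edgeFinset.card = s)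
    (w : V) (hw : 1 ≤ deg H w) (ht : (offEdges H w).card = t) (L : Finset V) (hwL : w ∉ L)
    (hL : ∀ e ∈ offEdges H w, (L.filter (fun x => x ∈ e)).card = 1)
    (hS : ∑ v, deg H v * deg H v + 2 * (t * (s - t - 1)) + 2 * j = s * (s + 1)) (q : ℕ) :
    2 * j + 2 * q * t ≤ 2 * t + t * (t - 1) + L.card * (q * (q + 1)) := by
  have hdec := sum_deg_sq_vertex_decomposition H w
  have hcard := card_offEdges_add_deg H w
  rw [ht, hm] at hcard
  rw [ht] at hdec
  have hsum := sum_offDeg_eq_card_of_once H w L hL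
  rw [ht] at hsum
  have hP := sum_offDeg_mul_pred_le H w L hwL
  have htan : ∀ x ∈ L, 2 * q * offDeg H w x ≤ offDeg H w x * (offDeg H w x - 1) + q * (q + 1) :=
    fun x _ => two_mul_le_mul_pred_add _ q
  have hsum2 := sum_le_sum htan
  rw [sum_add_distrib, sum_const, smul_eq_mul, ← mul_sum, hsum] at hsum2
  obtain ⟨d', hd⟩ : ∃ d', deg H w = d' + 1 := ⟨deg H w - 1, by omega⟩
  rw [hd] at hdec hcard
  obtain rfl : s = d' + 1 + t := by omega
  have e : d' + 1 + t - t - 1 = d' := by omega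
  rw [e, hdec] at hS
  have hkey : 2 * attach H w + offAdjPairs H w + 2 * j = t * (t + 1) := by
    zify at hS ⊢
    linear_combination hS
  rcases Nat.eq_zero_or_pos t with rfl | hpos
  · omega
  obtain ⟨t', rfl⟩ : ∃ t', t = t' + 1 := ⟨t - 1, by omega⟩
  rw [Nat.add_sub_cancel]
  nlinarith

/-- **THE BAND BOUND OF THE ROW `a`** (`a`-bipartite `D`, `|A| = a`, `|E| + r = a (k − a)`, `r + 1 ≤ k`): a missing
graph with a left star centre `w ∈ A` of degree `r − t` (`1 ≤ r − t`) at the band value `2 t (r − t − 1) + 2 j`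
obeys `2 j + 2 q t ≤ 2 t + t (t − 1) + (a − 1) q (q + 1)` for every `q`. -/
theorem row_band_bound (k a r t j : ℕ) (hk : r + 1 ≤ k) (D : SimpleGraph (Fin k)) [DecidableRel D.Adj]
    (A : Finset (Fin k)) (hA : A.card = a) (hB : BipSub D A) (hm : D.edgeFinset.card + r = a * (k - a))
    (w : Fin k) (hwA : w ∈ A) (hw : deg (missingGraph D A) w + t = r) (hw1 : 1 ≤ deg (missingGraph D A) w)
    (heq : ∑ v, deg D v * deg D v + r * (k - 1 - r) + (2 * (t * (r - t - 1)) + 2 * j) = D.edgeFinset.card * k)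
    (q : ℕ) : 2 * j + 2 * q * t ≤ 2 * t + t * (t - 1) + (a - 1) * (q * (q + 1)) := by
  have hcard : Fintype.card (Fin k) = k := Fintype.card_fin k
  have hH := bipSub_sum_deg_sq_add_disjEdgePairs D A hB a r hA (by rw [hcard]; exact hm) (by rw [hcard]; exact hk)
  rw [hcard] at hH
  have hr : (missingGraph D A).edgeFinset.card = r := card_edges_missingGraph D A hB a r hA (by rw [hcard]; exact hm)
  have hid := sum_deg_sq_add_disjEdgePairs (missingGraph D A)
  rw [hr] at hid
  have hS : ∑ v, deg (missingGraph D A) v * deg (missingGraph D A) v + 2 * (t * (r - t - 1)) + 2 * j =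
      r * (r + 1) := by
    omega
  have hoff := card_offEdges_add_deg (missingGraph D A) w
  rw [hr] at hoff
  have ht : (offEdges (missingGraph D A) w).card = t := by omega
  have hL : ∀ e ∈ offEdges (missingGraph D A) w, ((A.erase w).filter (fun x => x ∈ e)).card = 1 := by
    intro e he
    rw [mem_offEdges, SimpleGraph.mem_edgeFinset] at he
    obtain ⟨he, hwe⟩ := he
    revert he hwe
    refine Sym2.ind (fun x y he hwe => ?_) e
    rw [SimpleGraph.mem_edgeSet, missingGraph_adj] at he
    rw [Sym2.mem_iff] at hwe
    rw [card_eq_one]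
    by_cases hx : x ∈ A
    · refine ⟨x, ?_⟩
      ext z
      simp only [mem_filter, mem_erase, Sym2.mem_iff, mem_singleton]
      constructor
      · rintro ⟨⟨hzw, hzA⟩, hz | hz⟩
        · exact hz
        · exfalso
          subst hz
          exact (he.1.mp hx) hzA
      · rintro rfl
        exact ⟨⟨fun h => hwe (Or.inl h.symm), hx⟩, Or.inl rfl⟩
    · have hy : y ∈ A := by
        by_contra hy
        exact hx (he.1.mpr hy)
      refine ⟨y, ?_⟩
      ext z
      simp only [mem_filter, mem_erase, Sym2.mem_iff, mem_singleton]
      constructor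
      · rintro ⟨⟨hzw, hzA⟩, hz | hz⟩
        · exfalso
          subst hz
          exact hx hzA
        · exact hz
      · rintro rfl
        exact ⟨⟨fun h => hwe (Or.inr h.symm), hy⟩, Or.inr rfl⟩
  have h := band_bound_of_left_ends (missingGraph D A) r t j hr w hw1 ht (A.erase w) (notMem_erase w A) hL hS q
  rw [card_erase_of_mem hwA, hA] at h
  exact h

/-- **THE BAND BOUND ON THE CELL** (`3 ≤ a`, `1 ≤ t`, `4 t + 3 ≤ r`, `2 r ≥ 4 t + 6 + t (t + 1)`, `a + t < r`,
`2 a + r ≤ k` (`r + 7 ≤ k` at `a = 3`), `2 t (r − t − 1) + t (t + 1) < stabGapFull k a r`): a `K₄⁻`-free graph at the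
band value `closed − (2 t (r − t − 1) + 2 j)` has `2 j + 2 q t ≤ 2 t + t (t − 1) + (a − 1) q (q + 1)` for every `q` —
for `a ≤ t` the band `t` of the row `a` is truncated. -/
theorem cherry_row_band_bound (k a r t : ℕ) (ha3 : 3 ≤ a) (ht : 1 ≤ t) (hr4 : 4 * t + 3 ≤ r)
    (hr : 4 * t + 6 + t * (t + 1) ≤ 2 * r) (hat : a + t < r) (hk : 2 * a + r ≤ k) (hk3 : a = 3 → r + 7 ≤ k)
    (hlt : 2 * (t * (r - t - 1)) + t * (t + 1) < stabGapFull k a r) (j : ℕ) (hj : 2 * j ≤ t * (t + 1))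
    (D : SimpleGraph (Fin k)) [DecidableRel D.Adj] (hK : K4mFree D) (hm : D.edgeFinset.card + r = a * (k - a))
    (heq : ∑ v, deg D v * deg D v + r * (k - 1 - r) + (2 * (t * (r - t - 1)) + 2 * j) = D.edgeFinset.card * k)
    (q : ℕ) : 2 * j + 2 * q * t ≤ 2 * t + t * (t - 1) + (a - 1) * (q * (q + 1)) := by
  obtain ⟨A, hA, hB, w, hw, hoff, -⟩ :=
    cherry_band_locus_level k a r t ha3 ht hr hr4 hk hk3 j hj (by omega) D hK hm heq
  have hcard : Fintype.card (Fin k) = k := Fintype.card_fin k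
  -- the star centre is a left vertex: a right vertex has at most `a < r − t` missing neighbours
  have hwA : w ∈ A := by
    by_contra hwA
    have h1 := deg_add_deg_missingGraph D A hB w
    rw [if_neg hwA, hA] at h1
    omega
  exact row_band_bound k a r t j (by omega) D A hA hB hm w hwA hw (by omega) heq q

end C047

end TriangleCap

end PercRepro
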